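import Literature.AnabelianGeometry.AbsoluteAnabelian.ArithmeticLineBundles
import Mathlib.NumberTheory.NumberField.ProductFormula
import HarnessLib

/-!
# [AbsTopIII] Def 5.9 (iii): DISCHARGE of `GlobalLogVolumeWellDefined` (the product formula)

Proof-only companion of `ArithmeticLineBundles.lean` (abc-iut-L4-t3): S. Mochizuki, *Topics in absolute
anabelian geometry III*, Def. 5.9 (iii), kurims manuscript p. 144 — the global log-volume
`μ^log_⊚(L) = Σ_{v arc} 2·μ^log_v(S_v) + Σ_{v non} μ^log_v(S_v)` "depends only on the isomorphism class of
`L⊞` and is independent of the choice of `ζ, ζ₀` [...] as is well-known from elementary number theory, i.e.,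
the so-called product formula".  The named fact `GlobalLogVolumeWellDefined F` (independence of the global
section `t` of a `⊠`-line bundle, for `F` totally imaginary so that the printed weight `2` is the
multiplicity of every archimedean place) is PROVED here from Mathlib's product formula
`NumberField.prod_abs_eq_one`, read additively: `Σ_w mult(w)·log|a|_w + Σ_v log‖a‖_v = 0` with
`log‖a‖_v = -ord_v(a)·log N(v)` (the tree's `Literature.IUT.LogVolume.adicAbv_eq_absNorm_zpow`).
No new definitions.
-/

noncomputable section

open NumberField IsDedekindDomain
open scoped Classical

namespace Literature.AnabelianGeometry.AbsoluteAnabelian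

variable (F : Type) [Field F] [NumberField F]

/-- `log ‖a‖_v = -ord_v(a) · log N(v)` at a finite place, for a unit `a ∈ F^×`.
[cite: MochizukiAbsTopIII2015, Def 5.9 (iii) p. 144] -/
theorem log_adicAbv_eq_neg_ordAt_mul (v : HeightOneSpectrum (𝓞 F)) (a : Fˣ) :
    Real.log (NumberField.HeightOneSpectrum.adicAbv F v (a : F)) =
      -(ordAt F v a : ℝ) * Real.log (Ideal.absNorm v.asIdeal : ℝ) := by
  rw [Literature.IUT.LogVolume.adicAbv_eq_absNorm_zpow F v a.ne_zero, Real.log_zpow]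
  push_cast
  ring

/-- `‖a‖_v ≠ 1` only at the finitely many finite places where `ord_v(a) ≠ 0`.
[cite: MochizukiAbsTopIII2015, Def 5.9 (iii) p. 144] -/
theorem mulSupport_adicAbv_subset (a : Fˣ) :
    (Function.mulSupport fun v : HeightOneSpectrum (𝓞 F) =>
        NumberField.HeightOneSpectrum.adicAbv F v (a : F)) ⊆ {v | ordAt F v a ≠ 0} := by
  intro v hv
  simp only [Function.mem_mulSupport, ne_eq] at hv
  simp only [Set.mem_setOf_eq, ne_eq]
  intro h0
  apply hv
  rw [Literature.IUT.LogVolume.adicAbv_eq_absNorm_zpow F v a.ne_zero]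
  change (Ideal.absNorm v.asIdeal : ℝ) ^ (-(ordAt F v a)) = 1
  rw [h0, neg_zero, zpow_zero]

/-- **The product formula, additively**: for `a ∈ F^×`,
`Σ_{w | ∞} mult(w)·log|a|_w + Σ_{v ∤ ∞} log‖a‖_v = 0` (Mathlib `NumberField.prod_abs_eq_one`).
[cite: MochizukiAbsTopIII2015, Def 5.9 (iii) p. 144] -/
theorem sum_mult_mul_log_add_finsum_log_adicAbv (a : Fˣ) :
    (∑ w : InfinitePlace F, (w.mult : ℝ) * Real.log (w (a : F))) +
      ∑ᶠ v : HeightOneSpectrum (𝓞 F), Real.log (NumberField.HeightOneSpectrum.adicAbv F v (a : F)) = 0 := by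
  have ha : (a : F) ≠ 0 := a.ne_zero
  have hpf := NumberField.prod_abs_eq_one ha
  -- the finite part, re-indexed by maximal ideals
  have hB : ∏ᶠ w : FinitePlace F, w (a : F) =
      ∏ᶠ v : HeightOneSpectrum (𝓞 F), NumberField.HeightOneSpectrum.adicAbv F v (a : F) := by
    rw [← finprod_comp_equiv FinitePlace.equivHeightOneSpectrum.symm]
    simp only [FinitePlace.equivHeightOneSpectrum_symm_apply, FinitePlace.norm_embedding]
  rw [hB] at hpf
  -- both factors are positive
  have hApos : 0 < ∏ w : InfinitePlace F, w (a : F) ^ w.mult :=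
    Finset.prod_pos fun w _ => pow_pos (InfinitePlace.pos_iff.2 ha) _
  set s := (MulLineBundle.finite_setOf_ordAt_ne_zero (F := F) a).toFinset with hs
  have hsub : (Function.mulSupport fun v : HeightOneSpectrum (𝓞 F) =>
      NumberField.HeightOneSpectrum.adicAbv F v (a : F)) ⊆ s := by
    intro v hv
    rw [hs, Set.Finite.coe_toFinset]
    exact mulSupport_adicAbv_subset F a hv
  have hBprod : ∏ᶠ v : HeightOneSpectrum (𝓞 F), NumberField.HeightOneSpectrum.adicAbv F v (a : F) =
      ∏ v ∈ s, NumberField.HeightOneSpectrum.adicAbv F v (a : F) :=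
    finprod_eq_prod_of_mulSupport_subset _ hsub
  have hfac : ∀ v ∈ s, NumberField.HeightOneSpectrum.adicAbv F v (a : F) ≠ 0 :=
    fun v _ => ((NumberField.HeightOneSpectrum.adicAbv F v).pos ha).ne'
  have hBpos : 0 < ∏ v ∈ s, NumberField.HeightOneSpectrum.adicAbv F v (a : F) :=
    Finset.prod_pos fun v _ => (NumberField.HeightOneSpectrum.adicAbv F v).pos ha
  -- take logarithms
  have hlog := congrArg Real.log hpf
  rw [hBprod, Real.log_mul hApos.ne' hBpos.ne', Real.log_one,
    Real.log_prod (fun w _ => (pow_pos (InfinitePlace.pos_iff.2 ha) _).ne'), Real.log_prod hfac] at hlog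
  simp only [Real.log_pow] at hlog
  -- the finite sum is the finsum
  have hsum : ∑ᶠ v : HeightOneSpectrum (𝓞 F), Real.log (NumberField.HeightOneSpectrum.adicAbv F v (a : F)) =
      ∑ v ∈ s, Real.log (NumberField.HeightOneSpectrum.adicAbv F v (a : F)) := by
    refine finsum_eq_sum_of_support_subset _ ?_
    intro v hv
    apply hsub
    simp only [Function.mem_support, ne_eq] at hv
    simp only [Function.mem_mulSupport, ne_eq]
    intro h1
    exact hv (by rw [h1, Real.log_one])
  rw [hsum]
  exact hlog

/-- **DISCHARGE of `GlobalLogVolumeWellDefined`** ([AbsTopIII] Def. 5.9 (iii) p. 144: the global log-volume "is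
independent of the choice of `ζ, ζ₀` [...] the so-called product formula"): for `F` totally imaginary, the global
log-volume of a `⊠`-line bundle computed at a global section does not depend on the section.  Two sections
differ by `a ∈ F^×`, the local data shift by `ord_v(a)` resp. `-log|a|_v`, and the total change is the additive
product formula `sum_mult_mul_log_add_finsum_log_adicAbv` (with `mult = 2` at every complex place).
[cite: MochizukiAbsTopIII2015, Def 5.9 (iii) p. 144] -/
theorem GlobalLogVolumeWellDefined_holds : GlobalLogVolumeWellDefined F := by
  intro hcplx L q hq t t'
  obtain ⟨a, rfl⟩ := (L.bijective_smul t).2 t'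
  rw [globalLogVolume_eq, globalLogVolume_eq]
  simp only [MulLineBundle.localLogVolumes, L.τnon_smul, L.τarc_smul, negLogAt, Nat.cast_one, div_one]
  -- name the pieces
  set f : HeightOneSpectrum (𝓞 F) → ℝ := fun v => -(L.τnon v t : ℝ) * Real.log (q v) with hf
  set e : HeightOneSpectrum (𝓞 F) → ℝ := fun v => -(ordAt F v a : ℝ) * Real.log (q v) with he
  have hq' : ∀ v, (q v : ℝ) = (Ideal.absNorm v.asIdeal : ℝ) := fun v => by
    rw [hq v, Ideal.absNorm_apply, Submodule.cardQuot_apply]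
  -- finite supports
  have hfF : Function.HasFiniteSupport f := by
    refine (L.finite_support t).subset fun v hv => ?_
    simp only [Function.mem_support, ne_eq, hf] at hv
    simp only [Set.mem_setOf_eq, ne_eq]
    intro h0; exact hv (by rw [h0]; simp)
  have heF : Function.HasFiniteSupport e := by
    refine (MulLineBundle.finite_setOf_ordAt_ne_zero (F := F) a).subset fun v hv => ?_
    simp only [Function.mem_support, ne_eq, he] at hv
    simp only [Set.mem_setOf_eq, ne_eq]
    intro h0; exact hv (by rw [h0]; simp)
  -- split the finite part
  have hsplit : (∑ᶠ v, -((ordAt F v a + L.τnon v t : ℤ) : ℝ) * Real.log (q v)) = (∑ᶠ v, e v) + ∑ᶠ v, f v := by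
    rw [← finsum_add_distrib heF hfF]
    refine finsum_congr fun v => ?_
    simp only [he, hf]; push_cast; ring
  -- split the archimedean part
  have harc : (∑ v : InfinitePlace F, 2 * -(-Real.log (v (a : F)) + L.τarc v t)) =
      (∑ v : InfinitePlace F, 2 * Real.log (v (a : F))) + ∑ v : InfinitePlace F, 2 * -L.τarc v t := by
    rw [← Finset.sum_add_distrib]
    exact Finset.sum_congr rfl fun v _ => by ring
  rw [hsplit, harc]
  -- the shifts sum to zero by the product formula
  have hpf := sum_mult_mul_log_add_finsum_log_adicAbv F a
  have hmult : ∀ v : InfinitePlace F, (v.mult : ℝ) = 2 := fun v => by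
    rw [InfinitePlace.mult, if_neg (InfinitePlace.not_isReal_iff_isComplex.2 (hcplx v))]; norm_num
  simp only [hmult] at hpf
  have hfin : (∑ᶠ v : HeightOneSpectrum (𝓞 F),
      Real.log (NumberField.HeightOneSpectrum.adicAbv F v (a : F))) = ∑ᶠ v, e v :=
    finsum_congr fun v => by rw [log_adicAbv_eq_neg_ordAt_mul]; simp only [he, hq']
  rw [hfin] at hpf
  linarith

end Literature.AnabelianGeometry.AbsoluteAnabelian

namespace Literature.AnabelianGeometry.AbsoluteAnabelian

/-! ## Def 5.3 (iii): automorphisms of `⊞`-line bundles are roots of unity -/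

/-- Every `𝒪_F`-endomorphism of the rank-one torsion-free module `L⊞[⊚]` is multiplication by an element of
`𝒪_F`: it is multiplication by some `c ∈ F` (rank one), and `c` is integral over `𝒪_F` because the
endomorphism is (`Module.End.isIntegral`; transported to `c` by `Polynomial.scaleRoots`), hence `c ∈ 𝒪_F`
(integrally closed). [cite: MochizukiAbsTopIII2015, Def 5.3 (iii) p. 124] -/
theorem AddLineBundle.exists_end_eq_smul {F : Type} [Field F] [NumberField F] (L : AddLineBundle F) (φ : L.L →ₗ[𝓞 F] L.L) :
    ∃ c : 𝓞 F, ∀ y, φ y = c • y := by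
  obtain ⟨x, hx⟩ := L.exists_ne_zero
  obtain ⟨s, t, hst, h⟩ := L.exists_smul_add_smul_eq_zero x (φ x)
  have ht : t ≠ 0 := by
    rintro rfl
    rw [zero_smul, add_zero] at h
    rcases smul_eq_zero.mp h with hs | hx0
    · exact (hst.resolve_right fun h0 => h0 rfl) hs
    · exact hx hx0
  have hφx : t • φ x = -(s • x) := eq_neg_of_add_eq_zero_right h
  -- `t • φ = (-s) • id` everywhere
  have hall : ∀ y, t • φ y = (-s) • y := by
    intro y
    obtain ⟨s', t', hst', h'⟩ := L.exists_smul_add_smul_eq_zero y x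
    by_cases hy : y = 0
    · rw [hy, map_zero, smul_zero, smul_zero]
    have hs' : s' ≠ 0 := by
      rintro rfl
      rw [zero_smul, zero_add] at h'
      rcases smul_eq_zero.mp h' with h1 | h1
      · exact (hst'.resolve_left fun h0 => h0 rfl) h1
      · exact hx h1
    have e1 : s' • y = -(t' • x) := eq_neg_of_add_eq_zero_left h'
    have key : s' • (t • φ y - (-s) • y) = 0 := by
      have e2 : s' • (t • φ y) = -(t' • (t • φ x)) := by
        rw [smul_comm s' t, ← map_smul, e1, map_neg, map_smul, smul_neg, smul_comm t t']
      rw [smul_sub, e2, hφx, smul_comm s' (-s), e1]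
      simp only [smul_neg, neg_smul, neg_neg, smul_comm t' s, sub_self]
    rcases smul_eq_zero.mp key with h1 | h1
    · exact absurd h1 hs'
    · exact sub_eq_zero.mp h1
  -- `φ` is integral over `𝒪_F`
  obtain ⟨p, hp, hpφ⟩ : IsIntegral (𝓞 F) φ := Algebra.IsIntegral.isIntegral φ
  have hφe : algebraMap (𝓞 F) (Module.End (𝓞 F) L.L) t * φ =
      algebraMap (𝓞 F) (Module.End (𝓞 F) L.L) (-s) := by
    ext y
    simp only [Module.End.mul_apply, Module.algebraMap_end_apply, hall y]
  have hq : Polynomial.aeval (algebraMap (𝓞 F) (Module.End (𝓞 F) L.L) (-s)) (p.scaleRoots t) = 0 := by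
    rw [← hφe]
    exact Polynomial.scaleRoots_aeval_eq_zero hpφ
  have hev : Polynomial.eval (-s) (p.scaleRoots t) = 0 := by
    rw [Polynomial.aeval_algebraMap_apply_eq_algebraMap_eval] at hq
    have h1 := LinearMap.congr_fun hq x
    rw [Module.algebraMap_end_apply, LinearMap.zero_apply] at h1
    rcases smul_eq_zero.mp h1 with h2 | h2
    · exact h2
    · exact absurd h2 hx
  -- hence `c := -s/t ∈ F` is integral over `𝒪_F`, hence in `𝒪_F`
  have hinj : Function.Injective (algebraMap (𝓞 F) F) := RingOfIntegers.coe_injective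
  have htF : algebraMap (𝓞 F) F t ≠ 0 := (map_ne_zero_iff _ hinj).2 ht
  set c : F := algebraMap (𝓞 F) F (-s) / algebraMap (𝓞 F) F t with hcdef
  have hct : algebraMap (𝓞 F) F t * c = algebraMap (𝓞 F) F (-s) := mul_div_cancel₀ _ htF
  have hc : IsIntegral (𝓞 F) c := by
    refine ⟨p, hp, ?_⟩
    have h2 := Polynomial.scaleRoots_eval₂_mul (p := p) (algebraMap (𝓞 F) F) c t
    rw [hct, Polynomial.eval₂_at_apply, hev, map_zero] at h2
    exact (mul_eq_zero.mp h2.symm).resolve_left (pow_ne_zero _ htF)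
  obtain ⟨c₀, hc₀⟩ := (IsIntegrallyClosed.isIntegral_iff (R := 𝓞 F) (K := F)).mp hc
  have htc : t * c₀ = -s := hinj (by rw [map_mul, hc₀, hct])
  refine ⟨c₀, fun y => ?_⟩
  have h3 : t • (φ y - c₀ • y) = 0 := by
    rw [smul_sub, hall y, smul_smul, htc, sub_self]
  rcases smul_eq_zero.mp h3 with h4 | h4
  · exact absurd h4 ht
  · exact sub_eq_zero.mp h4

/-- An endomorphism of a `⊞`-line bundle, being multiplication by `c ∈ 𝒪_F`, contracts all archimedean norms
only if `|c|_v ≤ 1` at every archimedean `v`. [cite: MochizukiAbsTopIII2015, Def 5.3 (iii) p. 124] -/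
theorem AddLineBundle.apply_le_one_of_hom {F : Type} [Field F] [NumberField F] (L : AddLineBundle F) (f : AddLineBundle.Hom L L) {c : 𝓞 F}
    (hc : ∀ y, f.toLinearMap y = c • y) (w : InfinitePlace F) : w (c : F) ≤ 1 := by
  obtain ⟨x, hx⟩ := L.exists_ne_zero
  have hn : 0 < L.norm w x := lt_of_le_of_ne (L.norm_nonneg w x) fun h => hx ((L.norm_eq_zero_iff w x).mp h.symm)
  have h1 := f.norm_le w x
  rw [hc, L.norm_smul] at h1
  exact (mul_le_iff_le_one_left hn).mp h1

variable (F : Type) [Field F] [NumberField F]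

/-- **DISCHARGE of `AddLineBundleAutIsRootOfUnity`** ([AbsTopIII] Def. 5.3 (iii) p. 124: "the automorphism group of
any object [...] is naturally isomorphic to the finite abelian group `μ`"): an automorphism `f` of a `⊞`-line bundle
(with inverse `g`) is multiplication by a unit `u` of `𝒪_F` (`exists_end_eq_smul`), with `|u|_v ≤ 1` and
`|u⁻¹|_v ≤ 1`, i.e. `|u|_v = 1`, at every archimedean `v`; by Kronecker's theorem (Mathlib
`NumberField.Embeddings.pow_eq_one_of_norm_eq_one`) `u` is a root of unity. [cite: MochizukiAbsTopIII2015, Def 5.3 (iii) p. 124] -/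
theorem AddLineBundleAutIsRootOfUnity_holds : AddLineBundleAutIsRootOfUnity F := by
  intro L f g hfg hgf
  obtain ⟨c, hc⟩ := L.exists_end_eq_smul f.toLinearMap
  obtain ⟨d, hd⟩ := L.exists_end_eq_smul g.toLinearMap
  obtain ⟨x, hx⟩ := L.exists_ne_zero
  have hcd : c * d = 1 := by
    have h1 := LinearMap.congr_fun hfg x
    rw [LinearMap.comp_apply, LinearMap.id_apply, hd, hc, smul_smul] at h1
    have h2 : (c * d - 1) • x = 0 := by rw [sub_smul, one_smul, h1, sub_self]
    rcases smul_eq_zero.mp h2 with h3 | h3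
    · exact sub_eq_zero.mp h3
    · exact absurd h3 hx
  let u : (𝓞 F)ˣ := ⟨c, d, hcd, by rw [mul_comm]; exact hcd⟩
  have hwc : ∀ w : InfinitePlace F, w (c : F) = 1 := by
    intro w
    have h1 := L.apply_le_one_of_hom f hc w
    have h2 := L.apply_le_one_of_hom g hd w
    have h3 : w (c : F) * w (d : F) = 1 := by
      rw [← map_mul, ← map_mul, hcd, map_one, map_one]
    have h4 : w (c : F) * w (d : F) ≤ w (c : F) := mul_le_of_le_one_right (apply_nonneg w _) h2
    rw [h3] at h4
    exact le_antisymm h1 h4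
  refine ⟨u, ?_, ?_⟩
  · have hint : IsIntegral ℤ (c : F) := RingOfIntegers.isIntegral_coe c
    have hnorm : ∀ φ : F →+* ℂ, ‖φ (c : F)‖ = 1 := fun φ => by
      rw [← InfinitePlace.apply]; exact hwc _
    obtain ⟨n, hn, hcn⟩ := NumberField.Embeddings.pow_eq_one_of_norm_eq_one F ℂ hint hnorm
    rw [isOfFinOrder_iff_pow_eq_one]
    refine ⟨n, hn, Units.ext ?_⟩
    rw [Units.val_pow_eq_pow_val, Units.val_one]
    apply RingOfIntegers.coe_injective
    rw [map_pow, map_one]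
    exact hcn
  · ext y
    rw [hc, LinearMap.smul_apply, LinearMap.id_apply]

end Literature.AnabelianGeometry.AbsoluteAnabelian
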